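import Mathlib.RingTheory.Localization.Away.Basic
import Mathlib.RingTheory.Localization.Ideal
import Literature.AlgebraicGeometry.Resolution.WeightedResolutionDatum
import Summits.ResolutionOfSingularities.ResolutionOfSingularities.Theorems.WeightedInvariantWeightedConstructionExtReesLocalization

/-!
# Vertices and strict transforms under localisation of the base (crux `WeightedConstruction`, stub R2a)

Route `ResolutionOfSingularities/WeightedInvariant`, crux `WeightedConstruction`
(stmt-ResolutionOfSingularities-0571), line `support-first-weights-second`, stub
`stub_strictTransform_localization`.

Setting: `A' = A[1/h]`, `I'ₙ = Iₙ A'` for all `n`, `S = A[t⁻¹, Iₙ tⁿ] = extReesAlgebra I`,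
`S' = A'[t⁻¹, I'ₙ tⁿ] = extReesAlgebra I'`, and `ψ : S →+* S'` ANY ring map lying over the base
change of Laurent polynomials `A[t, t⁻¹] → A'[t, t⁻¹]` (hypothesis on coercions). We prove the
three facts the line needs in order to realise `B₊(D(h))` as an open piece of `B₊(U)` carrying the
same strict transform (Włodarczyk, arXiv:2203.03090, Def. 2.3.5 and 3.3.12; quasi-coherence of
`U ↦ Γ(B(U))`, App. Def. 5.1.1):

1. `ψ t⁻¹ = t⁻¹` (`strictTransformLoc_map_tInv`);
2. `(vertexIdeal I) S' = vertexIdeal I'` (`≤`: generators `a tⁿ` go to generators `(a/1) tⁿ`;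
   `≥`: a generator `a' tⁿ` with `a' ∈ Iₙ A'` satisfies `a' hᵏ = a/1` with `a ∈ Iₙ`
   (`IsLocalization.mem_map_algebraMap_iff`), so `a' tⁿ · C(hᵏ/1) = ψ (a tⁿ)` with `C(hᵏ/1)` a
   unit of `S'`);
3. `σˢ(𝔞) S' = σˢ(𝔞 A')` for every ideal `𝔞 ≤ A`, where `σˢ` is the `t⁻¹`-saturation of the
   extended ideal (`extReesAlgebra.mem_strictTransform_iff`). `≤` is formal (`ψ` commutes with
   the structure maps and fixes `t⁻¹`). For `≥` we use that `S'` is the localisation of `S` away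
   from `h` ALONG `ψ` (`stub_extReesAlgebra_localization` produces such a `ψ₀`, and `ψ = ψ₀`
   since both lie over the same map of Laurent polynomials and `S' → A'[t, t⁻¹]` is injective):
   if `t⁻ᵐ g' ∈ 𝔞 S'`, write `g' = ψ g / hᵏ'` (`IsLocalization.surj`); then
   `ψ (t⁻ᵐ g) ∈ (𝔞 S) S'`, so `t⁻ᵐ g hᵏ · hˡ = j hˡ` with `j ∈ 𝔞 S`
   (`IsLocalization.mem_map_algebraMap_iff`, `IsLocalization.eq_iff_exists`), i.e.
   `g hᵏ⁺ˡ ∈ σˢ(𝔞)`, and `g' = ψ (g hᵏ⁺ˡ) · (unit)⁻¹ ∈ σˢ(𝔞) S'`.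
-/

set_option linter.dupNamespace false -- mandated namespace of this single-conjunct summit

namespace Summit.ResolutionOfSingularities.ResolutionOfSingularities.Theorems

open CategoryTheory AlgebraicGeometry TopologicalSpace Literature.AlgebraicGeometry.Resolution
open scoped LaurentPolynomial
open LaurentPolynomial

section Helpers

variable {A A' : Type} [CommRing A] [CommRing A'] [Algebra A A']
  (I : ℕ → Ideal A) (I' : ℕ → Ideal A') (ψ : extReesAlgebra I →+* extReesAlgebra I')
  (hψ : ∀ x : extReesAlgebra I, ((ψ x : extReesAlgebra I') : A'[T;T⁻¹]) =
    AddMonoidAlgebra.mapRingHom ℤ (algebraMap A A') (x : A[T;T⁻¹]))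
include hψ

/-- A ring map of extended Rees algebras over the base change of Laurent polynomials fixes
`t⁻¹`. [folklore] -/
theorem strictTransformLoc_map_tInv : ψ (extReesAlgebra.tInv I) = extReesAlgebra.tInv I' := by
  apply Subtype.ext
  rw [hψ, extReesAlgebra.coe_tInv, extReesAlgebra.coe_tInv, extReesLoc_mapRingHom_T]

/-- A ring map of extended Rees algebras over the base change of Laurent polynomials commutes
with the structure maps from `A` and `A'`. [folklore] -/
theorem strictTransformLoc_map_algebraMap (a : A) :
    ψ (algebraMap A (extReesAlgebra I) a) =
      algebraMap A' (extReesAlgebra I') (algebraMap A A' a) := by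
  apply Subtype.ext
  rw [hψ, Subalgebra.coe_algebraMap, Subalgebra.coe_algebraMap, ← C_eq_algebraMap,
    ← C_eq_algebraMap, extReesLoc_mapRingHom_C]

/-- Extension of ideals along `A → S → S'` equals extension along `A → A' → S'`. [folklore] -/
theorem strictTransformLoc_map_map (𝔞 : Ideal A) :
    (𝔞.map (algebraMap A (extReesAlgebra I))).map ψ =
      (𝔞.map (algebraMap A A')).map (algebraMap A' (extReesAlgebra I')) := by
  rw [Ideal.map_map, Ideal.map_map]
  congr 1
  exact RingHom.ext fun a => strictTransformLoc_map_algebraMap I I' ψ hψ a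

/-- The vertex ideal extends into the vertex ideal, as soon as `Iₙ A' ⊆ I'ₙ`: the generator
`a tⁿ` goes to the generator `(a/1) tⁿ`. [folklore] -/
theorem strictTransformLoc_vertexIdeal_map_le (hle : ∀ n, (I n).map (algebraMap A A') ≤ I' n) :
    (extReesAlgebra.vertexIdeal I).map ψ ≤ extReesAlgebra.vertexIdeal I' := by
  unfold extReesAlgebra.vertexIdeal
  rw [Ideal.map_span]
  apply Ideal.span_le.mpr
  rintro _ ⟨x, ⟨n, hn, a, ha, hx⟩, rfl⟩
  apply Ideal.subset_span
  refine ⟨n, hn, algebraMap A A' a, hle n (Ideal.mem_map_of_mem _ ha), ?_⟩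
  rw [hψ, hx, map_mul, extReesLoc_mapRingHom_C, extReesLoc_mapRingHom_T]

/-- Over `A' = A[1/h]` with `I'ₙ = Iₙ A'`, the vertex ideal of `S'` is generated by the image of
the vertex ideal of `S`: a generator `a' tⁿ` (`a' ∈ Iₙ A'`) has `a' · hᵏ/1 = a/1` with `a ∈ Iₙ`,
so `a' tⁿ · C(hᵏ/1) = ψ (a tⁿ)` with `C(hᵏ/1)` a unit. [folklore] -/
theorem strictTransformLoc_le_vertexIdeal_map (h : A) [IsLocalization.Away h A']
    (heq : ∀ n, I' n = (I n).map (algebraMap A A')) :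
    extReesAlgebra.vertexIdeal I' ≤ (extReesAlgebra.vertexIdeal I).map ψ := by
  apply Ideal.span_le.mpr
  rintro x' ⟨n, hn, a', ha', hx'⟩
  rw [heq n] at ha'
  obtain ⟨⟨⟨a, ha⟩, ⟨_, k, rfl⟩⟩, e⟩ :=
    (IsLocalization.mem_map_algebraMap_iff (Submonoid.powers h) A').mp ha'
  have e' : a' * algebraMap A A' (h ^ k) = algebraMap A A' a := e
  -- the generator `a tⁿ` of the vertex ideal upstairs
  have hx₀mem : (⟨C a * T (n : ℤ), extReesAlgebra.C_mul_T_mem I hn ha⟩ : extReesAlgebra I) ∈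
      extReesAlgebra.vertexIdeal I :=
    Ideal.subset_span ⟨n, hn, a, ha, rfl⟩
  have hu : IsUnit (algebraMap A' (extReesAlgebra I') (algebraMap A A' (h ^ k))) := by
    rw [map_pow]
    exact ((IsLocalization.Away.algebraMap_isUnit h).pow k).map _
  have hprod : x' * algebraMap A' (extReesAlgebra I') (algebraMap A A' (h ^ k)) =
      ψ ⟨C a * T (n : ℤ), extReesAlgebra.C_mul_T_mem I hn ha⟩ := by
    apply Subtype.ext
    rw [MulMemClass.coe_mul, Subalgebra.coe_algebraMap, ← C_eq_algebraMap, hx', hψ]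
    change _ = AddMonoidAlgebra.mapRingHom ℤ (algebraMap A A') (C a * T (n : ℤ))
    rw [map_mul, extReesLoc_mapRingHom_C, extReesLoc_mapRingHom_T, ← e', map_mul]
    ring
  exact (Ideal.mul_unit_mem_iff_mem _ hu).mp (hprod ▸ Ideal.mem_map_of_mem ψ hx₀mem)

/-- The strict transform extends into the strict transform: if `t⁻ᵐ g ∈ 𝔞 S` then
`t⁻ᵐ ψ g = ψ (t⁻ᵐ g) ∈ 𝔞 S'`. [folklore] -/
theorem strictTransformLoc_strictTransform_map_le (𝔞 : Ideal A) :
    (extReesAlgebra.strictTransform I 𝔞).map ψ ≤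
      extReesAlgebra.strictTransform I' (𝔞.map (algebraMap A A')) := by
  rw [Ideal.map_le_iff_le_comap]
  intro g hg
  rw [Ideal.mem_comap]
  obtain ⟨m, hm⟩ := (extReesAlgebra.mem_strictTransform_iff I).mp hg
  refine (extReesAlgebra.mem_strictTransform_iff I').mpr ⟨m, ?_⟩
  rw [← strictTransformLoc_map_map I I' ψ hψ, ← strictTransformLoc_map_tInv I I' ψ hψ, ← map_pow,
    ← map_mul]
  exact Ideal.mem_map_of_mem ψ hm

/-- Over `A' = A[1/h]` with `I'ₙ = Iₙ A'`, the strict transform of `𝔞 A'` is generated by the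
image of the strict transform of `𝔞`: `S'` is the localisation of `S` away from `h` along `ψ`
(`stub_extReesAlgebra_localization` and uniqueness of `ψ` over the base change), and
denominators are cleared with `IsLocalization.surj`, `IsLocalization.mem_map_algebraMap_iff`,
`IsLocalization.eq_iff_exists`. [folklore] -/
theorem strictTransformLoc_le_strictTransform_map (h : A) [IsLocalization.Away h A']
    (heq : ∀ n, I' n = (I n).map (algebraMap A A')) (𝔞 : Ideal A) :
    extReesAlgebra.strictTransform I' (𝔞.map (algebraMap A A')) ≤
      (extReesAlgebra.strictTransform I 𝔞).map ψ := by
  -- `S'` is the localisation of `S` away from `h`, along `ψ`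
  obtain ⟨ψ₀, hψ₀, hloc⟩ := stub_extReesAlgebra_localization h I I' heq
  have hψeq : ψ₀ = ψ := RingHom.ext fun x => Subtype.ext (by rw [hψ₀, hψ])
  have hloc' : @IsLocalization.Away (extReesAlgebra I) _ (algebraMap A (extReesAlgebra I) h)
      (extReesAlgebra I') _ ψ.toAlgebra := hψeq ▸ hloc
  letI : Algebra (extReesAlgebra I) (extReesAlgebra I') := ψ.toAlgebra
  set x : extReesAlgebra I := algebraMap A (extReesAlgebra I) h with hxdef
  haveI : IsLocalization.Away x (extReesAlgebra I') := hloc'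
  have halg : ∀ p, algebraMap (extReesAlgebra I) (extReesAlgebra I') p = ψ p := fun _ => rfl
  intro g' hg'
  obtain ⟨m, hm⟩ := (extReesAlgebra.mem_strictTransform_iff I').mp hg'
  rw [← strictTransformLoc_map_map I I' ψ hψ] at hm
  -- `g' = ψ g / hᵏ'`
  obtain ⟨⟨g, ⟨_, k', rfl⟩⟩, eg⟩ := IsLocalization.surj (Submonoid.powers x) g'
  have eg' : g' * ψ (x ^ k') = ψ g := eg
  -- `ψ (t⁻ᵐ g) ∈ (𝔞 S) S'`
  have hm' : algebraMap _ (extReesAlgebra I') (extReesAlgebra.tInv I ^ m * g) ∈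
      (𝔞.map (algebraMap A (extReesAlgebra I))).map
        (algebraMap (extReesAlgebra I) (extReesAlgebra I')) := by
    rw [halg, map_mul, map_pow, strictTransformLoc_map_tInv I I' ψ hψ, ← eg', ← mul_assoc]
    exact Ideal.mul_mem_right _ _ hm
  -- clear denominators: `t⁻ᵐ g hᵏ hˡ = j hˡ` with `j ∈ 𝔞 S`
  obtain ⟨⟨⟨j, hj⟩, ⟨_, k, rfl⟩⟩, ej⟩ :=
    (IsLocalization.mem_map_algebraMap_iff (Submonoid.powers x) (extReesAlgebra I')).mp hm'
  have ej' : algebraMap _ (extReesAlgebra I') (extReesAlgebra.tInv I ^ m * g * x ^ k) =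
      algebraMap _ (extReesAlgebra I') j := by
    rw [map_mul]
    exact ej
  obtain ⟨⟨_, l, rfl⟩, el⟩ :=
    (IsLocalization.eq_iff_exists (Submonoid.powers x) (extReesAlgebra I')).mp ej'
  have el' : x ^ l * (extReesAlgebra.tInv I ^ m * g * x ^ k) = x ^ l * j := el
  -- hence `g hᵏ⁺ˡ ∈ σˢ(𝔞)`
  have hgσ : g * x ^ (k + l) ∈ extReesAlgebra.strictTransform I 𝔞 := by
    refine (extReesAlgebra.mem_strictTransform_iff I).mpr ⟨m, ?_⟩
    have : extReesAlgebra.tInv I ^ m * (g * x ^ (k + l)) =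
        x ^ l * (extReesAlgebra.tInv I ^ m * g * x ^ k) := by ring
    rw [this, el']
    exact Ideal.mul_mem_left _ _ hj
  -- and `g' = ψ (g hᵏ⁺ˡ) · (unit)⁻¹`
  have hu : IsUnit (ψ (x ^ (k' + (k + l)))) := by
    rw [← halg, map_pow]
    exact (IsLocalization.Away.algebraMap_isUnit x).pow _
  have hprod : g' * ψ (x ^ (k' + (k + l))) = ψ (g * x ^ (k + l)) := by
    rw [pow_add, map_mul, ← mul_assoc, eg', ← map_mul]
  exact (Ideal.mul_unit_mem_iff_mem _ hu).mp (hprod ▸ Ideal.mem_map_of_mem ψ hgσ)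

end Helpers

/-- **Vertices and strict transforms under localisation of the base** (Włodarczyk,
arXiv:2203.03090, Def. 2.3.5, 3.3.12, App. Def. 5.1.1). Let `A' = A[1/h]`, `I'ₙ = Iₙ A'`, and let
`ψ : A[t⁻¹, Iₙ tⁿ] → A'[t⁻¹, I'ₙ tⁿ]` be any ring map over the base change of Laurent polynomials.
Then `ψ t⁻¹ = t⁻¹`, the vertex ideal extends to the vertex ideal, and for every ideal `𝔞 ≤ A` the
strict transform `σˢ(𝔞)` extends to the strict transform `σˢ(𝔞 A')`. Consumed by the line
`support-first-weights-second` (through `stub_cobordantPlus_basicOpen_openImmersion`) to identify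
`B₊(D(h))`, its exceptional divisor and its strict transforms with the open piece of `B₊(U)` over
`D(h)`. [cite: Wlodarczyk2022, 3.3.12] -/
theorem stub_strictTransform_localization :
    ∀ {A A' : Type} [CommRing A] [CommRing A'] [Algebra A A'] (h : A) [IsLocalization.Away h A']
      (I : ℕ → Ideal A) (I' : ℕ → Ideal A'), (∀ n, I' n = (I n).map (algebraMap A A')) →
      ∀ (ψ : extReesAlgebra I →+* extReesAlgebra I'),
        (∀ x : extReesAlgebra I, ((ψ x : extReesAlgebra I') : A'[T;T⁻¹]) =
            AddMonoidAlgebra.mapRingHom ℤ (algebraMap A A') (x : A[T;T⁻¹])) →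
        ψ (extReesAlgebra.tInv I) = extReesAlgebra.tInv I' ∧
        (extReesAlgebra.vertexIdeal I).map ψ = extReesAlgebra.vertexIdeal I' ∧
        ∀ 𝔞 : Ideal A, (extReesAlgebra.strictTransform I 𝔞).map ψ =
          extReesAlgebra.strictTransform I' (𝔞.map (algebraMap A A')) := by
  intro A A' _ _ _ h _ I I' heq ψ hψ
  refine ⟨strictTransformLoc_map_tInv I I' ψ hψ, ?_, fun 𝔞 => ?_⟩
  · exact le_antisymm (strictTransformLoc_vertexIdeal_map_le I I' ψ hψ fun n => (heq n).ge)
      (strictTransformLoc_le_vertexIdeal_map I I' ψ hψ h heq)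
  · exact le_antisymm (strictTransformLoc_strictTransform_map_le I I' ψ hψ 𝔞)
      (strictTransformLoc_le_strictTransform_map I I' ψ hψ h heq 𝔞)

end Summit.ResolutionOfSingularities.ResolutionOfSingularities.Theorems
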